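import Mathlib
import HarnessLib
import HarnessLib.Audit
import Summits.QuantumAdvantage.Statement
import Literature.Computability.Cryptography.ClassBQP
import Literature.Computability.Complexity.Promise
import Literature.Computability.Complexity.Oracle
import Literature.Computability.Complexity.ProbabilisticClasses
import Summits.QuantumAdvantage.QuantumAdvantage.Theorems.RandomOracleGaugePromiseTransfer
import HarnessLib.Audit.Status.Attr

/-!
Route: SpikesNeedAddresses

# Route SpikesNeedAddresses — an L1-weighted Talagrand inequality for bounded low-degree polynomials
(WT) proves the Aaronson–Ambainis conjecture and discharges the bridge hypothesis of the
random-oracle gauge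

It suffices to show X = WT (WEIGHTED TALAGRAND AT LOW DEGREE; realises idea card
spikes-need-addresses, K1): there are absolute
constants b, C such that every real polynomial p of total degree ≤ d (d ≥ 1) with 0 ≤ p ≤ 1 on
{0,1}^N satisfies
Var[p]² ≤ C·d^b·Σᵢ I¹ᵢ[p]·Iᵢ[p], where Var, Iᵢ[p] = E_x(p(x) − p(xⁱ))² and I¹ᵢ[p] = E_x|p(x) −
p(xⁱ)| are the tree's `boolVariance`, `influence i p` (L²
influence) and L¹ influence, all three written INLINE over Mathlib since rev 1 (cone repair: `let ev
:= x ↦ MvPolynomial.eval (0/1-coding of x) p`,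
`let avg := f ↦ (Σₓ f x)/2^N`, xⁱ = `Function.update x i (!x i)`; definitionally equal to the tree
vocabulary, Iff.rfl in the planner's Equiv.lean). Talagrand's 1994
inequality penalises spiky derivatives by log(‖∂ᵢf‖₂/‖∂ᵢf‖₁) for ALL f; WT replaces the ratio by the
WEIGHT ‖∂ᵢ‖₁ itself and
"all f" by "deg ≤ d, bounded", with a poly(d) loss. Given the in-print L¹ budget Σᵢ I¹ᵢ[p] ≤ 2d²
(FilmusEtAl2016 Thm 1.1/3.3,
Markov–Bernstein; item FHKLTotalL1) one line gives the Aaronson–Ambainis conjecture with the optimal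
ε-exponent 2:
maxᵢ Iᵢ ≥ Var²/(C d^b Σᵢ I¹ᵢ) ≥ Var²/(2C d^(b+2)) (item WTGivesAA, whose conclusion is
`AAConjecture` written out verbatim).
That statement is exactly the bridge hypothesis `AAConj` of the served route RandomOracleGauge (card
random-oracle-promise-gauge),
whose three cruxes are re-asked here — PromiseLanguageLift verbatim (shared item
stmt-QuantumAdvantage-0250), PromiseTransfer and
RandomOracleHeurSeparation with `randomOracleMeasure` = setBer(univ, 1/2) and `AvgPRel` unfolded
verbatim (rev 1 cone repair; defeq to the shared
items stmt-QuantumAdvantage-10749 / -1131 that RandomOracleGauge keeps by name, Iff.rfl in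
Equiv.lean, so a proof of either form closes both):
WT ∧ FHKLTotalL1 ∧ WTGivesAA ∧ PromiseTransfer ∧ RandomOracleHeurSeparation ∧ PromiseLanguageLift →
QuantumAdvantage (glue.lean,
sorry-free). The second ranked crux TransitiveVariance (TV: transitive-symmetric bounded p of degree
d have Var ≤ C d^b/N^c) is the
necessary consequence of WT (item WTGivesTV) and of the Aaronson–Ambainis conjecture itself that
gives the line its two-sided test.
Lean: `∃ (b : ℕ) (C : ℝ), 0 < C ∧ ∀ (N d : ℕ) (p : MvPolynomial (Fin N) ℝ), let ev : (Fin N → Bool)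
→ ℝ := fun x => MvPolynomial.eval (fun i => if x i then (1 : ℝ) else 0) p; let avg : ((Fin N → Bool)
→ ℝ) → ℝ := fun f => (∑ x : Fin N → Bool, f x) / (2 : ℝ) ^ N; 1 ≤ d → p.totalDegree ≤ d → (∀ x, 0 ≤
ev x ∧ ev x ≤ 1) → (avg fun x => (ev x - avg ev) ^ 2) ^ 2 ≤ C * (d : ℝ) ^ b * ∑ i : Fin N, (avg fun
x => |ev x - ev (Function.update x i (!x i))|) * (avg fun x => (ev x - ev (Function.update x i (!x
i))) ^ 2)`

## Assembly
Pure logic plus the one-line reduction, sorry-free in Sketch.lean / glue.lean: WTGivesAA turns WT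
and FHKLTotalL1 into the
Aaronson–Ambainis conjecture verbatim, which is the antecedent of PromiseTransfer; then exactly
RandomOracleGauge's deciding
argument: ¬QuantumAdvantage ⇒ BQP ⊆ BPP ⇒ (PromiseLanguageLift) PromiseBQP ⊆ PromiseBPP' ⇒
(PromiseTransfer, AA) ∀ᵐ A, BQP^A ⊆ AvgP^A,
contradicting RandomOracleHeurSeparation. `closes : WeightedTalagrand → FHKLTotalL1 → WTGivesAA →
PromiseTransfer →
RandomOracleHeurSeparation → PromiseLanguageLift → QuantumAdvantage` (axioms propext,
Classical.choice, Quot.sound; rev 1: same five-line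
proof over the restated items, natively re-certified). TransitiveVariance,
WTGivesTV and WeightedTalagrandDegTwo are the test rung and the proved cases; they are not
hypotheses of `closes`.

Rationale: WHY THIS LINE. The only poly(d)-lossy step missing from the Aaronson–Ambainis conjecture is flatness
of the discrete derivatives: the
O'Donnell–Zhao–Wright "one-liner" (ODonnellZhao2016 §2.2, Thm 2.13) and FilmusEtAl2016 Prop. 3.18
lose e^(2d) by applying
hypercontractivity ‖∂ᵢp‖₂ ≤ e^d‖∂ᵢp‖₁ to EACH variable, which is tight for a single AND-spike; WT
instead weights the
Poincaré/Talagrand chain by ‖∂ᵢp‖₁ and spends the ℓ¹ budget Σᵢ‖∂ᵢp‖₁ ≤ d², which is POLYNOMIAL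
because it comes from
approximation theory (Markov–Bernstein / Sarantopoulos on the inward segment, FilmusEtAl2016 Thm
3.3), so flatness is asked only
in aggregate: many tall thin derivative spikes must be paid for by influential "address" variables
(the address function is the
equality shape). Imported areas: discrete isoperimetry (Talagrand1994,
CorderoErausquinEskenazis2023: the L¹/L² influence
inequality, here transplanted from a log penalty for all f to a polynomial penalty at low degree),
approximation theory (Markov
inequality), analysis of Boolean functions (ODonnellSaksSchrammServedio2005 OSSS for the ±1-valued
case, DinurEtAl2007 =
tree-proved `dfko2007_influence_bounded` for the 2^O(d) case). WT is proved for d ≤ 2 (constant 2 in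
tree units: Poincaré +
Cauchy–Schwarz + fourth-moment flatness of affine Rademacher forms + the budget) and for ±1-valued f
(OSSS + Nisan–Smolensky
D(f) ≤ 2 deg(f)⁴, BuhrmanDewolf2002 §4), and it implies AAConjecture (AaronsonAmbainis2014 Conj. 6)
with exponent 2, optimal by
linear forms. What it does that prior routes do not: RandomOracleGauge files AAConj as a support
hypothesis "nobody on this route
attacks"; no open route of the summit has an engine for it (Theses grep: only RandomOracleGauge and
PathInvolution mention
influences, the latter for Hadamard gates); the negatives index (3 refuted statements: two-qubit
frames, Shor marginals, Kummer
sector) has nothing on bounded polynomials.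

RANKED CRUXES. #2 WeightedTalagrand (crux) — WT (card K1): ∃ b C > 0, for all N, d ≥ 1 and real p of
total degree ≤ d with 0 ≤ p ≤ 1 on {0,1}^N: Var[p]² ≤ C d^b Σᵢ (E_x|p(x) − p(xⁱ)|)·Iᵢ[p] (cube
averages written inline over Mathlib since rev 1 — definitionally the tree's
`boolVariance`/`influence`/L¹ influence, Iff.rfl in the planner's Equiv.lean). Known cases: d ≤ 2
(item WeightedTalagrandDegTwo), ±1-valued p (OSSS + Nisan–Smolensky, C d^b = 4d⁸·const), equivalent
for one-block-decoupled f by ODonnellZhao2016 Thm 2.13-type decoupling. [difficulty: open-problem]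
(why it might fail: False with a degree-free constant (Tribes: ratio n/log²n at real degree n), so
d^b is the whole content; at d ≥ 3 a bounded 'soft address' system (many tall thin selectors whose
address bits carry little L¹·L² influence) would break it; evidence is only d ≤ 2, ±1-valued f,
searches at N ≤ 10.) [ODonnellZhao2016, FilmusEtAl2016, Talagrand1994, AaronsonAmbainis2014,
LovettZhang2023]
#3 TransitiveVariance (crux) — TV (card K2, the transitive rung): ∃ b, C, c > 0 such that every real
p of total degree ≤ d (d ≥ 1) with 0 ≤ p ≤ 1 on {0,1}^N (N ≥ 1) that is invariant under a transitive
family of coordinate permutations (∀ i j ∃ σ, σ i = j ∧ p ∘ σ = p on the cube) has Var[p] ≤ C d^b /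
N^c. Implied by WT + FHKLTotalL1 with (b+3, 8C, c = 1) (item WTGivesTV) and by AAConjecture with
exponent c' ≥ 2 (c = 1/(c'−1)); first open rung: d = C₀ log N with Var = o(1). A transitive
counterexample refutes WT, AAConjecture and RandomOracleGauge's bridge at once. [difficulty:
open-problem] (why it might fail: A transitive (cyclic / Cayley-graph) bounded family of degree
polylog N with variance ≥ N^{-o(1)} refutes it, and the Aaronson–Ambainis conjecture with it; in
print only Var ≤ d⁴e^{2d}/n (FilmusEtAl2016 Prop. 3.18), trivial for d ≥ C log n.) [FilmusEtAl2016,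
AaronsonAmbainis2014, ODonnell2014]
#4 RandomOracleHeurSeparation (crux) — thesis X of route RandomOracleGauge, re-asked with
`randomOracleMeasure`/`AvgPRel` unfolded verbatim (rev 1 cone repair; defeq by Iff.rfl to the shared
item stmt-QuantumAdvantage-1131, which RandomOracleGauge keeps by name): the conclusion of AA14 Thm
7(iii) FAILS — the set of oracles A with BQP^A ⊄ AvgP^A has positive randomOracleMeasure. It is the
S-side hypothesis through which AAConjecture (hence WT) bears on the summit: X ∧ PromiseTransfer ∧
AAConj ⟹ PromiseBQP ⊄ PromiseBPP'. [difficulty: open-problem] (why it might fail: Hypothesis-type,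
out of reach, shared with RandomOracleGauge: FALSE iff quantum decision advantage vanishes on
average relative to a random oracle (AAConj ∧ PromiseBQP ⊆ PromiseBPP' kills it via
PromiseTransfer); TRUE needs a BQP ⊄ HeurBPP-type witness, hence PP ≠ BPP.) [AaronsonAmbainis2014,
FortnowRogers1999JCSS, arXiv:2204.02063,
Literature.Barriers.QuantumAdvantage.aaronsonAmbainis2014_thm7iii]
#5 PromiseTransfer (crux) — the promise transfer T_avg of route RandomOracleGauge, re-asked with the
same unfoldings (rev 1; defeq by Iff.rfl to the shared item stmt-QuantumAdvantage-10749):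
(Aaronson–Ambainis conjecture, written out) → (PromiseBQP ⊆ PromiseBPP') → ∀ᵐ A, BQP^A ⊆ AvgP^A —
AA14 Thm 23 with P = P^#P replaced by PromiseBQP ⊆ PromiseBPP' (4T-wise independent hashing + BBBV
prefix descent). Its antecedent is literally the conclusion of WTGivesAA. [difficulty: L] (why it
might fail: New theorem (AA14 Thm 23 with P = P^#P ↦ PromiseBQP ⊆ PromiseBPP'), shared with
RandomOracleGauge: fails as typed if prBPP' coins cannot be absorbed by AvgPRel's deterministic
transcript machine, or if AA's greedy is not robust to w/2-vs-w gapped influence tests.)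
[AaronsonAmbainis2014, doi:10.1007/978-3-642-32009-5_44, arXiv:quant-ph/9701001,
doi:10.1137/0222080]
#6 PromiseLanguageLift (crux) — the promise lift PL shared with routes PromiseLift (PlLift,
stmt-QuantumAdvantage-0250) and RandomOracleGauge: BQP ⊆ BPP → PromiseBQP ⊆ PromiseBPP'.
[difficulty: open-problem] (why it might fail: False iff BQP ⊆ BPP while PromiseBQP ⊄ PromiseBPP'
(advantage confined to promise inputs); the classical analogue prP = prBPP from P = BPP is open
(Goldreich 2011 §6); shared with PromiseLift / RandomOracleGauge.) [Goldreich2011,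
AaronsonArkhipovToC2013, FortnowRogers1999JCSS]
#9 FHKLTotalL1 (support) — the L¹ budget (card P2), in print: for real p of total degree ≤ d with 0
≤ p ≤ 1 on {0,1}^N, Σᵢ E_x|p(x) − p(xⁱ)| ≤ 2d². FilmusEtAl2016 Thm 1.1 = Thm 3.3 gives d² for f = 2p
− 1 via Sarantopoulos' Banach-space Bernstein–Markov inequality (their fᵢ = p(x) − p(xⁱ)); the
constant 2d² stated here follows from the classical Markov inequality |h'| ≤ 2d²·max|h − ½| on [0,1]
applied to h(s) = p̃(x + s(xᴬ − x)) (p̃ the multilinear extension, bounded on the solid cube), one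
sign class A at a time (their remark after Prop. 3.1). Needs V. Markov's inequality, not in Mathlib.
[difficulty: M] [FilmusEtAl2016, Markov1958]
#9 WTGivesAA (support) — the one-line reduction (card P1): WT ∧ FHKLTotalL1 ⟹ the Aaronson–Ambainis
conjecture written out verbatim (inline cube averages; `Iff.rfl` with
`Literature.Computability.QuantumComplexity.AAConjecture` and syntactically the antecedent of
PromiseTransfer, certified in Sketch.lean / Equiv.lean): Var² ≤ C d^b (maxᵢ Iᵢ)(Σᵢ I¹ᵢ) ≤ 2C d^(b+2)
maxᵢ Iᵢ, so with ε ≤ Var ≤ 1 take c := b + 2, C' := 1/(2C). Real algebra over finite sums (N = 0 is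
vacuous since then Var = 0 < ε). [difficulty: provable-now] [ODonnellZhao2016, AaronsonAmbainis2014]
#9 WTGivesTV (support) — WT ∧ FHKLTotalL1 ⟹ TV with c = 1: under a transitive symmetry all Iᵢ are
equal (influence is invariant under coordinate permutations preserving p), so Iᵢ = (Σⱼ Iⱼ)/N ≤
4d·Var/N (tree `sum_influence_eq`: Σⱼ Iⱼ = 4Σ_S |S| p̂(S)² with Fourier support ≤ d,
`cubeFourierCoeff_evalBool_eq_zero`), whence Var² ≤ C d^b (4dVar/N)(2d²), i.e. Var ≤ 8C d^(b+3)/N.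
Makes "¬TV kills WT" a ledger edge. [difficulty: provable-now] [FilmusEtAl2016, ODonnell2014]
#9 WeightedTalagrandDegTwo (support) — WT at degree ≤ 2 with an explicit constant (card P1, tree
units): for real p of total degree ≤ 2 with 0 ≤ p ≤ 1 on {0,1}^N, Var[p]² ≤ 2 Σᵢ I¹ᵢ[p] Iᵢ[p]. Chain
(gives 3/2): Var ≤ ¼Σᵢ Iᵢ (Poincaré, `sum_influence_eq`); (Σᵢ Iᵢ)² ≤ (Σᵢ aᵢ)(Σᵢ aᵢ³), aᵢ = √Iᵢ
(Cauchy–Schwarz); p(x) − p(xⁱ) = ±Lᵢ with Lᵢ an affine form in the other Rademachers (deg ≤ 2,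
`evalBool_sub_evalBool_flipBit`), and E L⁴ ≤ 3(E L²)² for affine Rademacher forms gives ‖Lᵢ‖₂ ≤
√3‖Lᵢ‖₁ (Hölder), i.e. aᵢ ≤ √3 I¹ᵢ; finally Σᵢ I¹ᵢ ≤ 8 (FHKLTotalL1 at d = 2, where Markov for
quadratics is the three-point identity h'(0) = −3h(0) + 4h(½) − h(1)). Worst ratio found
numerically: 1/12 (address function ADDR₁) — sanity.py in the planner folder. [difficulty:
provable-now] [FilmusEtAl2016, ODonnell2014, ODonnellZhao2016]

TWO-LAYER PLAN. Foreseen glued splits (filed only after a crux closes or stalls with a census):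
WeightedTalagrand ⇐ WTDecoupled → DecouplingTransfer →
WeightedTalagrand (WTDecoupled = WT for one-block-decoupled f = Σᵢ yᵢgᵢ(z), Σᵢ|gᵢ| ≤ 1: Var² ≤ C
d^b[Σᵢ‖gᵢ‖₁‖gᵢ‖₂² + Σⱼ I¹_zⱼ I_zⱼ];
DecouplingTransfer = the ODonnellZhao2016 Thm 2.13-type reduction with poly(d) loss for the weighted
quantity); then WTDecoupled ⇐
AddressNormalForm → SpreadSelectors → WTDecoupled (card K3: selectors that are products of bounded
block functions force an address bit
with Σᵢ‖∂ⱼgᵢ‖₂² ≥ poly(ε/d); the general-selector reduction is where hypercontractivity crept back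
into DFKO). TransitiveVariance ⇐
TVLogDegree (d ≤ C₀ log N ⇒ Var = o(1)) → TVBootstrap → TransitiveVariance. The RandomOracleGauge
items split, if at all, in that
route's tenure (its header: robust Thm 21 at query level / PromiseBQP-estimability via k-wise
independence / machine assembly).

KILL CRITERIA. (a) TransitiveVariance refuted (an explicit transitive bounded family of degree
N^o(1) with Var ≥ N^(-o(1))) ⇒ by WTGivesTV and
FHKLTotalL1 (both provable now) ¬WeightedTalagrand, and ¬AAConjecture: close
`refuted:WeightedTalagrand`, hand the witness to
RandomOracleGauge (its bridge dies) and to the barrier file RandomOracleMethod (clause (b) loses its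
hypothesis). (b) WeightedTalagrand
refuted by a NON-transitive family while AAConjecture survives (WT is stronger: ε-exponent 2 and an
ℓ¹-weighted sum instead of a
max) ⇒ pivot once: restate the crux as the unweighted aggregate form "maxᵢ Iᵢ · Σᵢ I¹ᵢ ≥ Var²/(C
d^b)" (still ⟹ AA by the same line)
or with Var^4; if that dies too, close refuted. (c) RandomOracleHeurSeparation refuted (a.s. BQP^A ⊆
AvgP^A proved) or
PromiseLanguageLift refuted ⇒ the S-arrow is gone for this route AND RandomOracleGauge; WT/TV keep
their value only as Literature-grade
targets ⇒ close `refuted:<Decl>` and re-card WT under whichever route then carries AAConjecture. (d)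
AAConjecture proved elsewhere
(BH-inequality programme SloteVolbergZhang2026, random restrictions Bhattacharya2024, decoupling)
moots WT's bridge role ⇒ close superseded.

NOT DECOMPOSED YET. The decoupling reduction and the address normal form (card K3) — layer-2
children of WeightedTalagrand, above; the value of b (card
target b = 4) and any explicit C; the p-biased / general product-space version of WT; the
Boolean-valued case as a separate item
(it is a remark: OSSS + Nisan–Smolensky); Markov's inequality as a Literature lemma (the prover of
FHKLTotalL1 decides where it
lands); the log-query, AAConj-free variant (RandomOracleGauge's LogQueryTransfer) — not this route's
business.

CHEAPEST FALSIFIER. The transitive rung at small size, already begun by the card's author: maximise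
N·Var over CYCLIC-invariant p with |p| ≤ 1 by LP
vertex search (Var is convex in the orbit coefficients and {|p| ≤ 1} is a polytope, so the maximum
sits at a vertex): N = 12,
d = 1,2,3,4 ↦ max N·Var ≥ 1.00, 2.75, 5.40, 6.97 (kit jobs j002382, j002326, j002383 of the
mechanism seat; growth ≈ d², no jump;
N = 14,16 queued there as j002385–j002387). TV predicts N·Var = O(d^(b+3)) uniformly in N; a refuter
extends the table to N = 16–20,
d ≤ 6 and looks for super-polynomial growth in d at fixed N·Var scaling, then tries structured
transitive log-degree designs
(cyclic AND/parity/character averages, |X̂(ω)|² features fed into a bounded univariate q). For WT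
itself: the family table of the
card (kit j002082/j002085/j002087: sup Var²/ΣI¹ᵢIᵢ = 9/8·(1/16) at d = 2, nothing above (4/3)/16 at
d = 3, N ≤ 10) plus this
planner's pure-python check sanity.py (random bounded p, N ≤ 7, d ≤ 4: max ratio 0.108; Σᵢ I¹ᵢ ≤ 2.5
≪ 2d²). Honest limit: finite d
cannot see poly-vs-exp; the decisive falsifier is a transitive log-degree family with Ω(1) variance.

NUMBERS. Tree units ([0,1]-valued p on {0,1}^N; Iᵢ = E(p − p∘flipᵢ)², I¹ᵢ = E|p − p∘flipᵢ|; for f =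
2p − 1 on {±1}ⁿ: Var f = 4 Var p,
‖∂ᵢf‖₂² = Iᵢ, ‖∂ᵢf‖₁ = I¹ᵢ). Budget: Σᵢ I¹ᵢ ≤ d² (FilmusEtAl2016 Thm 3.3, Sarantopoulos) resp. 2d²
(classical Markov; the item);
conjectured ≤ d (Bačkurs–Bavarian / FilmusEtAl2016 §5). Total L² influence Σᵢ Iᵢ ≤ 4d·Var ≤ 4d (tree
`sum_influence_le`).
Transitive: Var ≤ d⁴e^(2d)/n (FilmusEtAl2016 Prop. 3.18); symmetric d ≪ √n: Σ I¹ ≤ d + o(d) (ibid.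
§3.3). Unconditional AA-type
bounds: Iᵢ ≥ Var²/C^d (DinurEtAl2007; tree `dfko2007_influence_bounded_holds`), ±1-valued: maxᵢ Iᵢ ≥
Var/D(f) ≥ Var/(2d⁴) (OSSS +
Nisan–Smolensky). WT at d ≤ 2: constant 3/2 by the chain, 2 in the item, worst example 1/12 (ADDR₁,
MAJ₃-free degree-2 list:
AND₂ 0.070, linear forms 1/16). LovettZhang2023: fractional certificate complexity poly(d, 1/ε, log
n) (Thm 2/13); their Conj. 37 ⟹ AA
with a log n loss (Claim 38). Items at open: 10 (5 cruxes, 4 support, 1 assembly).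

DEFINITION REQUESTS. CONE (rev 1, route-repair 2026-08-15): the route file now imports only
Cryptography.ClassBQP, Complexity.Promise, Complexity.Oracle,
Complexity.ProbabilisticClasses — all inside the sub Statement's own import closure — so its MODULE
cone equals the Statement's: the 3
route-attributable unproved facts of rev 0 (yamakawa_zhandry via OracleSeparations.lean = home of
randomOracleMeasure; the open conjectures
AAConjecture / QuantumQuerySimulable via AaronsonAmbainis.lean = home of
boolAvg/evalBool/flipBit/boolVariance/influence; both re-imported by the
barrier file Literature/Barriers/QuantumAdvantage/RandomOracleMethod.lean = home of AvgPRel) are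
gone; no item ever used them as hypotheses. needs-fact:
none. What is
left (8: BQPEqBPP, BQPQTM_eq_BQP, BQPQTMWith_adhAmplitudes, FactInP, lenstra_pomerance,
NFSConjecture, FactoringInFP,
harvey_factoring_one_fifth) rides on the operator-owned Statement.lean's docstring-only imports
QuantumComplexity.BQP / QuantumTuring and is
shared by every route of the summit (operator). PRICE: cube averages, setBer(univ, 1/2) and AvgP^A
are written inline (defeq, Iff.rfl:
Equiv.lean attached as item evidence). DEFINITION ITEMS FILED (hoists; names unchanged, no new
facts): defn-BooleanInfluence = move boolAvg/evalBool/flipBit/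
boolVariance/influence (+ their four folklore lemmas) out of AaronsonAmbainis.lean into
QuantumComplexity/BooleanInfluence.lean and rewire
InfluenceBounds.lean to it; defn-RandomOracleVocabulary = move randomOracleMeasure (+ instance) out
of OracleSeparations.lean and
errFraction/AvgPRel/PRel_subset_AvgPRel out of Barriers/QuantumAdvantage/RandomOracleMethod.lean
into fact-free modules re-imported by their
old homes; afterwards an imports-only edit can re-state these items BY NAME (and makes
RandomOracleGauge's 1131/10749 cone-clean too).
PROVER NOTE (module cone, until defn-BooleanInfluence lands): the gate links a proved item into this
file by `import …Theorems.<Name>` +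
`theorem <Decl>_holds`, so the Theorems file's imports join the route's module cone. Import
InfluenceBounds.lean freely (sum_influence_eq,
sum_influence_le, cubeFourierCoeff_evalBool_eq_zero, evalBool_sub_evalBool_flipBit; `change`/`show`
the inline `let`s into
boolVariance/influence/boolAvg first — they are defeq) — it becomes conjecture-free when the hoist
rewires it — but do NOT import
AaronsonAmbainis.lean, DFKOInfluenceBound.lean, OracleSeparations.lean or
Barriers/QuantumAdvantage/RandomOracleMethod.lean directly in a
Theorems file for WeightedTalagrand(DegTwo)/TransitiveVariance/FHKLTotalL1/WTGivesAA/WTGivesTV; the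
S-side items (PromiseTransfer,
RandomOracleHeurSeparation) will need the random-oracle machinery anyway and should wait for
defn-RandomOracleVocabulary. Optional as before: `l1Influence i p` next to `influence` (card D1);
FilmusEtAl2016 Thm 1.1 stays the provable
support item FHKLTotalL1, not a cite-fact.

Novelty: Searches (2026-08-15): `lit galaxy search "Aaronson-Ambainis conjecture" --star all` (9 rows:
Montanaro arXiv:1208.0161 talk,
Defant–Mastyło–Pérez arXiv:1706.03670 (BH/Fourier spectrum), ECCC TR24-035, 4 irrelevant LNCS
volumes); `lit galaxy search
"Talagrand's influence inequality" --star all` (1 row: DACQA 2021 school proceedings, READ via `lit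
galaxy read
pdf:-6786177813743824340`: chapters on OSSS, vector-valued Talagrand inequalities =
CorderoErausquinEskenazis2023, DFKO, BH
inequalities — all log-penalised / all-f or exp(d)); `lit search --source zbmath "Fractional
certificates for bounded functions
Lovett"` (3 rows → LovettZhang2023, READ pp. 1–3, 11–12 from the DROPS pdf: Conj. 1, Thm 2/13, Conj.
32, Claim 33, Conj. 37
"Talagrand for L∞", Claim 38); `lit read arxiv:1404.3396` (FilmusEtAl2016: Thm 3.3, Prop. 3.1–3.2,
Prop. 3.18, §4–5 read);
`lit read arxiv:0911.0996` (App. 6 Thm 27 read: it is R = O(Q²) for partial symmetric f, NOT a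
variance bound — the card's "Thm 27
(symmetric)" pointer corrected here); `lit frontier QuantumAdvantage --since 2022` (30 rows, none on
AAConjecture; AaronsonAmbainis2014
is unresolved in the citation graph); `lit bridges QuantumAdvantage --cross any` (nothing relevant);
`lit search` local/ --hybrid:
searchd rc 75 this session; OpenAlex/S2 HTTP 429; arXiv API 0 rows for the LZ title. Tree:
AAConjecture docstring (status list
2026-08-15), InfluenceBounds.lean, DFKOInfluenceBound(Proofs).lean, Theses/RandomOracleGauge.lean
rev 5, negatives i  [refs: 1208.0161, 1706.03670, 1404.3396, 0911.0996, arxiv:1404.3396, arxiv:0911.0996, CorderoErausquinEskenazis2023, LovettZhang2023, FilmusEtAl2016, AaronsonAmbainis2014, ODonnellZhao2016, Talagrand1994]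

Barriers (technique_class: boolean-fourier-analysis, talagrand-isoperimetry): - technique_class: boolean-fourier-analysis, talagrand-isoperimetry
- Literature.Barriers.QuantumAdvantage.RandomOracleMethod: not evaded — SHARPENED and then USED:
AAConjecture is the hypothesis of its clause (b) (`aaronsonAmbainis2014_thm7iii`, tree-proved with P
= P^#P); WT ⟹ AAConjecture makes clause (b) unconditional in its analytic half, and the S-arrow runs
through RandomOracleGauge's reading of the same clause (PromiseTransfer: P = P^#P ↦ PromiseBQP ⊆
PromiseBPP') plus its hypothesis-type X; the bet is that X (average-case decision advantage relative
to a random oracle) is true, which this route inherits and does not improve.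
- Literature.Barriers.QuantumAdvantage.TotalFunctionSpeedupLimit: same family ("need for structure",
`bealsEtAl2001_thm54` lineage): WT ⟹ AA14 Thm 7(i) (`AaronsonAmbainis2014_thm7_holds`:
QuantumQuerySimulable) unconditional — a barrier-STRENGTHENING, negative-side deliverable, declared
as such; it does not obstruct the line because the line's S-content is entirely in the shared
RandomOracleGauge items.
- Literature.Barriers.QuantumAdvantage.SeparationPrerequisites: applies to the S-arrow only through
RandomOracleHeurSeparation (X ∧ AAConj ⟹ PromiseBQP ⊄ PromiseBPP' ⟹ PP ⊄ BPP); it does not apply to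
WT/TV/FHKL, which are inequalities about bounded polynomials and imply no class separation;
conceded, not evaded.
- Literature.Barriers.QuantumAdvantage.Relativization: n/a to the analytic items (no oracle
construction); the S-arrow is RandomOracleGau

History (route lifecycle, newest last):
- 2026-08-15T18:37:32Z · rev 1: restated WeightedTalagrand (stmt-QuantumAdvantage-11490), TransitiveVariance (stmt-QuantumAdvantage-11491), RandomOracleHeurSeparation (stmt-QuantumAdvantage-1131), PromiseTransfer (stmt-QuantumAdvantage-10749), FHKLTotalL1 (stmt-QuantumAdvantage-11492), WTGivesAA (stmt-QuantumAdvantage-11493), WeightedTalagrand (planner-rrepair-QuantumAdvantage-SpikesNeedAdd-bc213a60-0)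
- 2026-08-15T18:43:02Z · rev 2: restated WTGivesTV (stmt-QuantumAdvantage-11494) — route-repair (cone) rev 2, render fix only: WTGivesTV (stmt-QuantumAdvantage-11494, `WeightedTalagrand → FHKLTotalL1 → TransitiveVariance`) was rendered as a TO (planner-rrepair-QuantumAdvantage-SpikesNeedAdd-bc213a60-0)
- 2026-08-26T13:38:04Z · DORMANT — reconciler: no traction for 7.1 d (last activity item-proof-filed at 2026-08-19T10:05:32Z); parked, not closed — `ledger route dormant route-QuantumAdvantage-Sp (operator:999:3003969)
- 2026-08-29T10:38:16Z · REACTIVATED — reconciler: reactivated — activity statement-checked at 2026-08-29T09:00:29Z after parking at 2026-08-26T13:38:04Z (operator:999:2915589)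

sub-problem: QuantumAdvantage · status: open · opened planner-plancard-QuantumAdvantage-QuantumAdva-2931ad50-0 2026-08-15T18:14:01Z · rev 3 · ledger route-QuantumAdvantage-SpikesNeedAddresses
GENERATED by the gate from the ledger (D-0016/17). Provers cite these decls: `theorem foo : Summit.QuantumAdvantage.QuantumAdvantage.Theses.SpikesNeedAddresses.<Decl> := …` in Summits/QuantumAdvantage/QuantumAdvantage/Theorems/<Name>.lean.
-/

namespace Summit.QuantumAdvantage.QuantumAdvantage.Theses.SpikesNeedAddresses

open scoped BigOperators Topology Manifold Classical MeasureTheory ProbabilityTheory Matrix InnerProductSpace ComplexConjugate ContinuousMap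
open Filter Set Function TopologicalSpace MeasureTheory

attribute [summit_statement] _root_.QuantumAdvantage

open Literature.QuantumAdvantage

-- earlier WeightedTalagrand (stmt-QuantumAdvantage-11490, replaced 2026-08-15T18:37:32Z -> stmt-QuantumAdvantage-11699): retired by None — ∃ (b : ℕ) (C : ℝ), 0 < C ∧ ∀ (N d : ℕ) (p : MvPolynomial (Fin N) ℝ), 1 ≤ d → p.totalDegree ≤ d → (∀ x, 0 ≤ Literature.Computability.QuantumComplexity.evalBool p x ∧ Literature.Computability.QuantumComplexity.evalBool p x ≤ 1) → (Literature.Computability.QuantumCo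
/-- item stmt-QuantumAdvantage-11699 · crux · rank 2 · open · by planner
why it might fail: Strictly stronger than the open AA conjecture (ε-exponent 2, ℓ¹-weighted sum); d-free constant false (symmetric Chebyshev steps: ratio ≍ d/16; Tribes n/log²n); Poincaré proves it for N ≤ 16C·d^b, so refuting needs d = N^{o(1)} soft-pointer families, untested; evidence: d ≤ 2, ±1-valued f, N ≤ 10.
sources: AaronsonAmbainis2014 (ToC Conj. 1.7 = arXiv:0911.0996 Conj. 6), ODonnellZhao2016 (Thm 2.13, §2.2 one-liner), FilmusEtAl2016 (arXiv:1404.3396 Thm 3.3, Prop. 3.18), Talagrand1994, CorderoErausquinEskenazis2023, LovettZhang2023 (Conj. 37, Claim 38)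
[crux] WT (card K1): ∃ b C > 0, for all N, d ≥ 1 and real p of total degree ≤ d with 0 ≤ p ≤ 1 on
{0,1}^N: Var[p]² ≤ C d^b Σᵢ (E_x|p(x) − p(xⁱ)|)·Iᵢ[p], Iᵢ[p] = E_x(p(x) − p(xⁱ))². Cone repair rev
1: the cube averages are written INLINE over Mathlib (`let ev := x ↦ MvPolynomial.eval (0/1-coding
of x) p`, `let avg := f ↦ (Σₓ f x)/2^N`, xⁱ = `Function.update x i (!x i)`) instead of the tree's
evalBool/boolAvg/flipBit/boolVariance/influence — DEFINITIONALLY EQUAL to the rev-0 statement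
(Iff.rfl, planner evidence Equiv.lean), so every tree lemma on `boolVariance`/`influence`/`boolAvg`
applies after `show`/`change`/`intro`; sole purpose: keep AaronsonAmbainis.lean (home of the open
conjectures AAConjecture/QuantumQuerySimulable) out of the route's module cone. Known cases: d ≤ 2
(item WeightedTalagrandDegTwo), ±1-valued p (OSSS + Nisan–Smolensky, C d^b = 4d⁸·const), equivalent
for one-block-decoupled f by ODonnellZhao2016 Thm 2.13-type decoupling. [difficulty: open-problem] -/
@[route_item "route-QuantumAdvantage-SpikesNeedAddresses", crux]
def WeightedTalagrand : Prop :=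
  ∃ (b : ℕ) (C : ℝ), 0 < C ∧ ∀ (N d : ℕ) (p : MvPolynomial (Fin N) ℝ), let ev : (Fin N → Bool) → ℝ := fun x => MvPolynomial.eval (fun i => if x i then (1 : ℝ) else 0) p; let avg : ((Fin N → Bool) → ℝ) → ℝ := fun f => (∑ x : Fin N → Bool, f x) / (2 : ℝ) ^ N; 1 ≤ d → p.totalDegree ≤ d → (∀ x, 0 ≤ ev x ∧ ev x ≤ 1) → (avg fun x => (ev x - avg ev) ^ 2) ^ 2 ≤ C * (d : ℝ) ^ b * ∑ i : Fin N, (avg fun x => |ev x - ev (Function.update x i (!x i))|) * (avg fun x => (ev x - ev (Function.update x i (!x i))) ^ 2)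

-- earlier TransitiveVariance (stmt-QuantumAdvantage-11491, replaced 2026-08-15T18:37:32Z -> stmt-QuantumAdvantage-11700): retired by None — ∃ (b : ℕ) (C c : ℝ), 0 < c ∧ ∀ (N d : ℕ) (p : MvPolynomial (Fin N) ℝ), 1 ≤ N → 1 ≤ d → p.totalDegree ≤ d → (∀ x, 0 ≤ Literature.Computability.QuantumComplexity.evalBool p x ∧ Literature.Computability.QuantumComplexity.evalBool p x ≤ 1) → (∀ i j : Fin N, ∃ σ : Eq
/-- item stmt-QuantumAdvantage-11700 · crux · rank 3 · open · by planner
why it might fail: Open between FHKL Prop 3.18 (Var ≤ d⁴e^{2d}/n, void for d ≥ ½ln n) and the Boolean case; false iff a transitive bounded family of degree n^{o(1)} keeps Var ≥ n^{-o(1)} (candidates: symmetrised acceptance polynomials of small-base transitive speedups, arXiv:2006.12760), refuting WT and AAConj too.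
sources: FilmusEtAl2016 (arXiv:1404.3396 Prop. 3.18, p. 10: transitive-invariant f of degree d has Var ≤ d⁴e^{2d}/n), AaronsonAmbainis2014 (Conj. 6 ⟹ TV with c = 1/(c'−1)), arXiv:2006.12760 (Ben-David–Childs–Gilyén–Kretschmer–Podder–Wang: primitive groups with base size n^{o(1)} admit super-polynomial speedups — the pool of transitive candidates), ODonnell2014 (Ch. 8 notes: AA conjecture; Poincaré/total influence ≤ d·Var)
[crux] TV (card K2, the transitive rung): ∃ b, C, c > 0 such that every real p of total degree ≤ d
(d ≥ 1) with 0 ≤ p ≤ 1 on {0,1}^N (N ≥ 1) that is invariant under a transitive family of coordinate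
permutations (∀ i j ∃ σ, σ i = j ∧ p ∘ σ = p on the cube) has Var[p] ≤ C d^b / N^c. Cone repair rev
1: the cube averages are written INLINE over Mathlib (`let ev := x ↦ MvPolynomial.eval (0/1-coding
of x) p`, `let avg := f ↦ (Σₓ f x)/2^N`, xⁱ = `Function.update x i (!x i)`) instead of the tree's
evalBool/boolAvg/flipBit/boolVariance/influence — DEFINITIONALLY EQUAL to the rev-0 statement
(Iff.rfl, planner evidence Equiv.lean), so every tree lemma on `boolVariance`/`influence`/`boolAvg`
applies after `show`/`change`/`intro`; sole purpose: keep AaronsonAmbainis.lean (home of the open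
conjectures AAConjecture/QuantumQuerySimulable) out of the route's module cone. Implied by WT +
FHKLTotalL1 with (b+3, 8C, c = 1) (item WTGivesTV) and by AAConjecture with exponent c' ≥ 2 (c =
1/(c'−1)); first open rung: d = C₀ log N with Var = o(1). A transitive counterexample refutes WT,
AAConjecture and RandomOracleGauge's bridge at once. [difficulty: open-problem] -/
@[route_item "route-QuantumAdvantage-SpikesNeedAddresses"]
def TransitiveVariance : Prop :=
  ∃ (b : ℕ) (C c : ℝ), 0 < c ∧ ∀ (N d : ℕ) (p : MvPolynomial (Fin N) ℝ), let ev : (Fin N → Bool) → ℝ := fun x => MvPolynomial.eval (fun i => if x i then (1 : ℝ) else 0) p; let avg : ((Fin N → Bool) → ℝ) → ℝ := fun f => (∑ x : Fin N → Bool, f x) / (2 : ℝ) ^ N; 1 ≤ N → 1 ≤ d → p.totalDegree ≤ d → (∀ x, 0 ≤ ev x ∧ ev x ≤ 1) → (∀ i j : Fin N, ∃ σ : Equiv.Perm (Fin N), σ i = j ∧ ∀ x : Fin N → Bool, ev (fun k => x (σ k)) = ev x) → (avg fun x => (ev x - avg ev) ^ 2) ≤ C * (d : ℝ) ^ b / (N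 : ℝ) ^ c

-- earlier RandomOracleHeurSeparation (stmt-QuantumAdvantage-1131, replaced 2026-08-15T18:37:32Z -> stmt-QuantumAdvantage-11701): open — ¬ ∀ᵐ A ∂Literature.Computability.QuantumComplexity.randomOracleMeasure, Literature.Computability.Cryptography.BQPRel (A : Language Bool) ⊆ Literature.Barriers.QuantumAdvantage.AvgPRel (Literature.Computability.Complexity.Oracle.ofLanguage (A : Language Bool))
/-- item stmt-QuantumAdvantage-11701 · crux · rank 4 · open · by planner
why it might fail: Hypothesis-type, out of reach, shared with RandomOracleGauge: FALSE iff quantum decision advantage vanishes on average relative to a random oracle (AAConj ∧ PromiseBQP ⊆ PromiseBPP' kills it via PromiseTransfer; here WT ⟹ AAConj); TRUE needs a BQP ⊄ HeurBPP-type witness, hence PP ≠ BPP.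
sources: AaronsonAmbainis2014 (Thm 7(iii) = arXiv:0911.0996 Thm 23; §1 p. 5), FortnowRogers1999JCSS, arXiv:2204.02063 (Yamakawa–Zhandry Thm 1.1: random-oracle advantage for NP SEARCH only), Literature.Barriers.QuantumAdvantage.aaronsonAmbainis2014_thm7iii, Literature.Barriers.QuantumAdvantage.SeparationPrerequisites
[crux] THESIS X of route RandomOracleGauge (hypothesis-type), RE-ASKED FOR THE CONE (rev 1) with the
tree definitions unfolded verbatim: randomOracleMeasure = setBer(univ, 1/2) on Set (List Bool)
(Mathlib `ProbabilityTheory.setBernoulli`), AvgPRel O = {L | ∃ poly-time OracleAlg M with polynomial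
query bound q whose error fraction at length n (inputs x ∈ {0,1}ⁿ with M.run O ≠ some [x ∈ L], over
2ⁿ) → 0} — DEFINITIONALLY EQUAL to the shared item stmt-QuantumAdvantage-1131 `¬ ∀ᵐ A
∂randomOracleMeasure, BQPRel A ⊆ AvgPRel (Oracle.ofLanguage A)` (Iff.rfl, planner evidence
Equiv.lean; a proof or refutation of either form closes the other by `Iff.rfl ▸`). Content: the
conclusion of AA14 Thm 7(iii) FAILS — the set of oracles A with BQP^A ⊄ AvgP^A (some BQP^A language
that no polynomial-time P^A transcript machine decides on a 1−o(1) fraction of the inputs of each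
length) has POSITIVE measure (equivalently measure 1: tail event). Under the Aaronson–Ambainis
conjecture, X ∧ PromiseTransfer ⟹ ¬(PromiseBQP ⊆ PromiseBPP') = PromiseLift.PlThesis. Inlined only
so that OracleSeparations.lean (home of the XL fact yamakawa_zhandry) and
Barriers/QuantumAdvantage/RandomOracleMethod.lean leave the modu -/
@[route_item "route-QuantumAdvantage-SpikesNeedAddresses", crux]
def RandomOracleHeurSeparation : Prop :=
  ¬ ∀ᵐ A ∂(ProbabilityTheory.setBernoulli (Set.univ : Set (List Bool)) ⟨1 / 2, by norm_num, by norm_num⟩), Literature.Computability.Cryptography.BQPRel (A : Language Bool) ⊆ {L : Language Bool | ∃ M : Literature.Computability.Complexity.OracleAlg Bool, M.IsPolyTime Computability.encodingBoolBool ∧ ∃ q : Polynomial ℕ, (∀ x : List Bool, ∀ y ∈ M.queries (Literature.Computability.Complexity.Oracle.ofLanguage (A : Language Bool)) (q.eval x.length) x, y.length ≤ q.eval x.length) ∧ Filter.Tendsto (fun n : ℕ => ((Finset.univ.filter fun x : List.Vector Bool n => M.run (Literature.Computability.Complexity.Oracle.ofLanguage (A : Language Bool)) (q.eval x.toList.length)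 x.toList ≠ some (Set.boolIndicator L x.toList)).card : ℝ) / 2 ^ n) Filter.atTop (nhds 0)}

-- earlier PromiseTransfer (stmt-QuantumAdvantage-10749, replaced 2026-08-15T18:37:32Z -> stmt-QuantumAdvantage-11702): proved by Summit.QuantumAdvantage.QuantumAdvantage.Theorems.RandomOracleGauge.PromiseTransfer_proof — (∃ (c : ℕ) (C : ℝ), 0 < C ∧ ∀ (N d : ℕ) (p : MvPolynomial (Fin N) ℝ) (ε : ℝ), 1 ≤ d → p.totalDegree ≤ d → (∀ x, 0 ≤ Literature.Computability.QuantumComplexity.evalBool p x ∧ Literat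
/-- item stmt-QuantumAdvantage-11702 · crux · rank 5 · closed · proved by Summit.QuantumAdvantage.QuantumAdvantage.Theorems.SpikesNeedAddresses.PromiseTransfer_proof (prover) · by planner
why it might fail: New theorem (AA14 Thm 23 with P = P^#P ↦ PromiseBQP ⊆ PromiseBPP'), shared with RandomOracleGauge: fails as typed if prBPP' coins cannot be absorbed by AvgPRel's deterministic transcript machine, or if AA's greedy is not robust to w/2-vs-w gapped influence tests.
sources: AaronsonAmbainis2014 (arXiv:0911.0996 Thm 21 pp. 13–14, Thm 23 p. 14), doi:10.1007/978-3-642-32009-5_44 (Zhandry 2012 Thm 3.1: 2q-wise independence vs q quantum queries), arXiv:quant-ph/9701001 (BBBV Thm 3.3 hybrid bound), doi:10.1137/0222080 (Kushilevitz–Mansour prefix descent), Literature.Barriers.QuantumAdvantage.AvgPRel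
[crux] PROMISE TRANSFER T_avg of route RandomOracleGauge, RE-ASKED FOR THE CONE (rev 1): antecedent
= the Aaronson–Ambainis conjecture written out with INLINE cube averages (defeq to
Literature.Computability.QuantumComplexity.AAConjecture, Iff.rfl), then PromiseBQP ⊆ PromiseBPP' by
name, conclusion ∀ᵐ A ∂ setBer(univ, 1/2), BQP^A ⊆ AvgP^A with randomOracleMeasure/AvgPRel unfolded
verbatim — DEFINITIONALLY EQUAL to the shared item stmt-QuantumAdvantage-10749 (Iff.rfl, Equiv.lean;
a proof of either form closes both). Content: Aaronson–Ambainis 2014 Thm 7(iii) (= Thm 23; tree fact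
aaronsonAmbainis2014_thm7iii, proved in RandomOracleMethodHolds.lean) with the hypothesis P = P^#P
REPLACED by PromiseBQP ⊆ PromiseBPP': run AA's greedy (Thm 21) on the acceptance polynomial of the
uniform oracle family; E_Y p, Var p, Inf_i p over a random completion become two-run oracle-free
circuits with an explicit 4T-wise independent hash (Zhandry 2012) and the influential-bit SEARCH a
BBBV/Kushilevitz–Mansour promise-gapped prefix descent, all PromiseBQP estimations, hence randomized
poly-time under the hypothesis; the AvgP^A machine stays deterministic by reading coins off oracle
positions beyond the -/
@[route_item "route-QuantumAdvantage-SpikesNeedAddresses", crux]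
def PromiseTransfer : Prop :=
  (∃ (c : ℕ) (C : ℝ), 0 < C ∧ ∀ (N d : ℕ) (p : MvPolynomial (Fin N) ℝ) (ε : ℝ), let ev : (Fin N → Bool) → ℝ := fun x => MvPolynomial.eval (fun i => if x i then (1 : ℝ) else 0) p; let avg : ((Fin N → Bool) → ℝ) → ℝ := fun f => (∑ x : Fin N → Bool, f x) / (2 : ℝ) ^ N; 1 ≤ d → p.totalDegree ≤ d → (∀ x, 0 ≤ ev x ∧ ev x ≤ 1) → 0 < ε → ε ≤ (avg fun x => (ev x - avg ev) ^ 2) → ∃ i : Fin N, C * (ε / d) ^ c ≤ (avg fun x => (ev x - ev (Function.update x i (!x i))) ^ 2)) → Literature.Computability.Cryptography.PromiseBQP ⊆ Literature.Computability.Complexity.PromiseBPP' → ∀ᵐ A ∂(ProbabilityTheory.setBernoulli (Set.univ : Set (List Bool)) ⟨1 / 2, by norm_num, by norm_num⟩), Literature.Computability.Cryptography.BQPRel (A : Language Bool) ⊆ {L : Language Bool | ∃ M : Literature.Computability.Complexity.OracleAlg Bool, M.IsPolyTime Computability.encodingBoolBool ∧ ∃ q : Polynomial ℕ, (∀ x :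 List Bool, ∀ y ∈ M.queries (Literature.Computability.Complexity.Oracle.ofLanguage (A : Language Bool)) (q.eval x.length) x, y.length ≤ q.eval x.length) ∧ Filter.Tendsto (fun n : ℕ => ((Finset.univ.filter fun x : List.Vector Bool n => M.run (Literature.Computability.Complexity.Oracle.ofLanguage (A : Language Bool)) (q.eval x.toList.length) x.toList ≠ some (Set.boolIndicator L x.toList)).card : ℝ) / 2 ^ n) Filter.atTop (nhds 0)}

-- `PromiseTransfer` holds: proved by `Summit.QuantumAdvantage.QuantumAdvantage.Theorems.SpikesNeedAddresses.PromiseTransfer_proof` (its module imports this route file, so no `_holds` link can be stated here).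

/-- item stmt-QuantumAdvantage-0250 · crux · rank 6 · open · by planner
why it might fail: False iff BQP ⊆ BPP while PromiseBQP ⊄ PromiseBPP' (advantage confined to promise inputs); the classical analogue prP = prBPP from P = BPP is open (Goldreich 2011 §6); no BQP-complete language is known; shared with PromiseLift / RandomOracleGauge.
sources: Goldreich2011 (§6 p. 28 + fn 27: the classical lift is open), AaronsonArkhipovToC2013 (§10 open problems (9)–(10)), FortnowRogers1999JCSS (Cor. 3.7: P = BQP with PH infinite, candidate counter-world), Literature.Barriers.QuantumAdvantage.TotalFunctionSpeedupLimit
OPEN structural question (analogue of 'P = BPP ⇒ prP = prBPP?', Goldreich2011 §1): does equality of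
the language classes force equality of the textbook promise classes? The obstruction: a PromiseBQP
family has no acceptance gap off the promise, so its threshold set is not a BQP language. Most
informative crux of the route: a proof makes every PromiseBQP-completeness result (Jones,
Forrelation) a bona fide reformulation of BQP ≠ BPP; a relativized counterexample would explain why
decision-level quantum advantage evidence is scarce. [Goldreich2006 §1.2; Goldreich2011; Watrous2009
§III.2] -/
@[route_item "route-QuantumAdvantage-SpikesNeedAddresses", crux]
def PromiseLanguageLift : Prop :=
  Literature.Computability.Cryptography.BQP ⊆ Literature.Computability.Complexity.BPP → Literature.Computability.Cryptography.PromiseBQP ⊆ Literature.Computability.Complexity.PromiseBPP'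

-- earlier FHKLTotalL1 (stmt-QuantumAdvantage-11492, replaced 2026-08-15T18:37:32Z -> stmt-QuantumAdvantage-11703): retired by None — ∀ (N d : ℕ) (p : MvPolynomial (Fin N) ℝ), p.totalDegree ≤ d → (∀ x, 0 ≤ Literature.Computability.QuantumComplexity.evalBool p x ∧ Literature.Computability.QuantumComplexity.evalBool p x ≤ 1) → ∑ i : Fin N, (Literature.Computability.QuantumComplexity.boolAvg fun x => |L
/-- item stmt-QuantumAdvantage-11703 · support · rank 9 · open · by planner
sources: FilmusEtAl2016 (arXiv:1404.3396 Thm 1.1 = Thm 3.3: Inf^(1)[f] ≤ d² for f : {−1,1}ⁿ → [−1,1], via Prop. 3.2 = Sarantopoulos 1991), BorweinErdelyi1995 (Thm 5.1.8: the Markov brothers' inequality |h′| ≤ d²·‖h‖ on [−1,1])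
[support] the L¹ budget (card P2), in print: for real p of total degree ≤ d with 0 ≤ p ≤ 1 on
{0,1}^N, Σᵢ E_x|p(x) − p(xⁱ)| ≤ 2d² (cube averages inline since rev 1, defeq to the rev-0 statement
over boolAvg/evalBool/flipBit by Iff.rfl). FilmusEtAl2016 Thm 1.1 = Thm 3.3 gives d² for f = 2p − 1
via Sarantopoulos' Banach-space Bernstein–Markov inequality (their fᵢ = p(x) − p(xⁱ)); the constant
2d² follows from the classical Markov inequality |h'| ≤ 2d²·max|h − ½| on [0,1] applied to h(s) =
p̃(x + s(xᴬ − x)) (p̃ the multilinear extension, bounded on the solid cube), one sign class A at a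
time (their remark after Prop. 3.1). Needs V. Markov's inequality, not in Mathlib. [difficulty: M] -/
@[route_item "route-QuantumAdvantage-SpikesNeedAddresses", crux]
def FHKLTotalL1 : Prop :=
  ∀ (N d : ℕ) (p : MvPolynomial (Fin N) ℝ), let ev : (Fin N → Bool) → ℝ := fun x => MvPolynomial.eval (fun i => if x i then (1 : ℝ) else 0) p; let avg : ((Fin N → Bool) → ℝ) → ℝ := fun f => (∑ x : Fin N → Bool, f x) / (2 : ℝ) ^ N; p.totalDegree ≤ d → (∀ x, 0 ≤ ev x ∧ ev x ≤ 1) → ∑ i : Fin N, (avg fun x => |ev x - ev (Function.update x i (!x i))|) ≤ 2 * (d : ℝ) ^ 2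

-- earlier WTGivesAA (stmt-QuantumAdvantage-11493, replaced 2026-08-15T18:37:32Z -> stmt-QuantumAdvantage-11704): retired by None — WeightedTalagrand → FHKLTotalL1 → ∃ (c : ℕ) (C : ℝ), 0 < C ∧ ∀ (N d : ℕ) (p : MvPolynomial (Fin N) ℝ) (ε : ℝ), 1 ≤ d → p.totalDegree ≤ d → (∀ x, 0 ≤ Literature.Computability.QuantumComplexity.evalBool p x ∧ Literature.Computability.QuantumComplexity.evalBool p x ≤ 1) → 0
/-- item stmt-QuantumAdvantage-11704 · support · rank 9 · open · by planner
sources: ODonnellZhao2016, AaronsonAmbainis2014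
[support] the one-line reduction (card P1): WT ∧ FHKLTotalL1 ⟹ the Aaronson–Ambainis conjecture
written out with inline cube averages (`Iff.rfl` with
`Literature.Computability.QuantumComplexity.AAConjecture`, and syntactically the antecedent of
PromiseTransfer; both certified in the planner's Sketch.lean / Equiv.lean): Var² ≤ C d^b (maxᵢ
Iᵢ)(Σᵢ I¹ᵢ) ≤ 2C d^(b+2) maxᵢ Iᵢ, so with ε ≤ Var ≤ 1 take c := b + 2, C' := 1/(2C). Real algebra
over finite sums (N = 0 is vacuous since then Var = 0 < ε). [difficulty: provable-now] -/
@[route_item "route-QuantumAdvantage-SpikesNeedAddresses", crux]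
def WTGivesAA : Prop :=
  WeightedTalagrand → FHKLTotalL1 → ∃ (c : ℕ) (C : ℝ), 0 < C ∧ ∀ (N d : ℕ) (p : MvPolynomial (Fin N) ℝ) (ε : ℝ), let ev : (Fin N → Bool) → ℝ := fun x => MvPolynomial.eval (fun i => if x i then (1 : ℝ) else 0) p; let avg : ((Fin N → Bool) → ℝ) → ℝ := fun f => (∑ x : Fin N → Bool, f x) / (2 : ℝ) ^ N; 1 ≤ d → p.totalDegree ≤ d → (∀ x, 0 ≤ ev x ∧ ev x ≤ 1) → 0 < ε → ε ≤ (avg fun x => (ev x - avg ev) ^ 2) → ∃ i : Fin N, C * (ε / d) ^ c ≤ (avg fun x => (ev x - ev (Function.update x i (!x i))) ^ 2)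

-- earlier WeightedTalagrandDegTwo (stmt-QuantumAdvantage-11495, replaced 2026-08-15T18:37:32Z -> stmt-QuantumAdvantage-11705): retired by None — ∀ (N : ℕ) (p : MvPolynomial (Fin N) ℝ), p.totalDegree ≤ 2 → (∀ x, 0 ≤ Literature.Computability.QuantumComplexity.evalBool p x ∧ Literature.Computability.QuantumComplexity.evalBool p x ≤ 1) → (Literature.Computability.QuantumComplexity.boolVariance p) ^ 2 ≤ 
/-- item stmt-QuantumAdvantage-11705 · support · rank 9 · open · by planner
sources: FilmusEtAl2016, ODonnell2014, ODonnellZhao2016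
[support] WT at degree ≤ 2 with an explicit constant (card P1; cube averages inline since rev 1,
defeq to the rev-0 statement by Iff.rfl): for real p of total degree ≤ 2 with 0 ≤ p ≤ 1 on {0,1}^N,
Var[p]² ≤ 2 Σᵢ I¹ᵢ[p] Iᵢ[p]. Chain (gives 3/2): Var ≤ ¼Σᵢ Iᵢ (Poincaré, tree `sum_influence_eq`
after `change`); (Σᵢ Iᵢ)² ≤ (Σᵢ aᵢ)(Σᵢ aᵢ³), aᵢ = √Iᵢ (Cauchy–Schwarz); p(x) − p(xⁱ) = ±Lᵢ with Lᵢ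
an affine form in the other Rademachers (deg ≤ 2, tree `evalBool_sub_evalBool_flipBit`), and E L⁴ ≤
3(E L²)² for affine Rademacher forms gives ‖Lᵢ‖₂ ≤ √3‖Lᵢ‖₁ (Hölder), i.e. aᵢ ≤ √3 I¹ᵢ; finally Σᵢ
I¹ᵢ ≤ 8 (FHKLTotalL1 at d = 2, where Markov for quadratics is the three-point identity h'(0) =
−3h(0) + 4h(½) − h(1)). Worst ratio found numerically: 1/12 (address function ADDR₁). [difficulty:
provable-now] -/
@[route_item "route-QuantumAdvantage-SpikesNeedAddresses"]
def WeightedTalagrandDegTwo : Prop :=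
  ∀ (N : ℕ) (p : MvPolynomial (Fin N) ℝ), let ev : (Fin N → Bool) → ℝ := fun x => MvPolynomial.eval (fun i => if x i then (1 : ℝ) else 0) p; let avg : ((Fin N → Bool) → ℝ) → ℝ := fun f => (∑ x : Fin N → Bool, f x) / (2 : ℝ) ^ N; p.totalDegree ≤ 2 → (∀ x, 0 ≤ ev x ∧ ev x ≤ 1) → (avg fun x => (ev x - avg ev) ^ 2) ^ 2 ≤ 2 * ∑ i : Fin N, (avg fun x => |ev x - ev (Function.update x i (!x i))|) * (avg fun x => (ev x - ev (Function.update x i (!x i))) ^ 2)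

-- earlier WTGivesTV (stmt-QuantumAdvantage-11494, replaced 2026-08-15T18:43:02Z -> stmt-QuantumAdvantage-11782): retired by None — WeightedTalagrand → FHKLTotalL1 → TransitiveVariance
/-- item stmt-QuantumAdvantage-11782 · support · rank 9 · open · by planner
sources: FilmusEtAl2016, ODonnell2014
[support] WT ∧ FHKLTotalL1 ⟹ TV with c = 1 (rev 2: uncurried form, re-issued only so that the decl
renders AFTER the rev-1 items FHKLTotalL1/TransitiveVariance it names — the rev-1 render had left it
as a TODO comment 'missing decl FHKLTotalL1' because items print in id order): under a transitive
symmetry all Iᵢ are equal (influence is invariant under coordinate permutations preserving p), so Iᵢ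
= (Σⱼ Iⱼ)/N ≤ 4d·Var/N (tree `sum_influence_eq`: Σⱼ Iⱼ = 4Σ_S |S| p̂(S)² with Fourier support ≤ d,
`cubeFourierCoeff_evalBool_eq_zero`, applied after `change` to the inline cube averages), whence
Var² ≤ C d^b (4dVar/N)(2d²), i.e. Var ≤ 8C d^(b+3)/N. Makes "¬TV kills WT" a ledger edge.
[difficulty: provable-now] -/
@[route_item "route-QuantumAdvantage-SpikesNeedAddresses"]
def WTGivesTV : Prop :=
  WeightedTalagrand ∧ FHKLTotalL1 → TransitiveVariance

/-- item stmt-QuantumAdvantage-11496 · assembly · rank 1 · closed · proved by Summit.QuantumAdvantage.QuantumAdvantage.Theorems.SpikesNeedAddresses.Assembly_proof @ 14e6512b64f3 (prover) · by planner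
sources: AaronsonAmbainis2014, ODonnellZhao2016
[assembly] WeightedTalagrand → FHKLTotalL1 → WTGivesAA → PromiseTransfer →
RandomOracleHeurSeparation → PromiseLanguageLift → QuantumAdvantage. -/
@[route_item "route-QuantumAdvantage-SpikesNeedAddresses"]
def Assembly : Prop :=
  WeightedTalagrand → FHKLTotalL1 → WTGivesAA → PromiseTransfer → RandomOracleHeurSeparation → PromiseLanguageLift → _root_.QuantumAdvantage

-- `Assembly` holds: proved by `Summit.QuantumAdvantage.QuantumAdvantage.Theorems.SpikesNeedAddresses.Assembly_proof` @ 14e6512b64f3 (its module imports this route file, so no `_holds` link can be stated here).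

/-! D-0027 §2.1 — DECIDING THEOREM (planner-authored via `route open/edit --closes-file`; by planner-rrepair-QuantumAdvantage-SpikesNeedAdd-bc213a60-0 2026-08-15T18:37:32Z):
its hypotheses are this route's items and its conclusion the sub-problem Statement (glue_lint), and it elaborates with this file. -/

/-- D-0027 §2.1 deciding theorem of route SpikesNeedAddresses (rev 1, cone repair: the seven vocabulary-bearing
items are restated over Statement-cone vocabulary + Mathlib, each definitionally equal to its rev-0 form; the
logic is unchanged): the weighted Talagrand inequality WT and the Filmus–Hatami–Keller–Lifshitz L¹ budget give
(WTGivesAA) the Aaronson–Ambainis conjecture written out, which is syntactically the antecedent of the promise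
transfer; the rest is RandomOracleGauge's contradiction: ¬Statement ⇒ BQP ⊆ BPP ⇒ (PromiseLanguageLift)
PromiseBQP ⊆ PromiseBPP' ⇒ (PromiseTransfer) a.s. BQP^A ⊆ AvgP^A over setBer(univ, 1/2), contradicting
RandomOracleHeurSeparation. -/
@[closes "route-QuantumAdvantage-SpikesNeedAddresses"] theorem closes (hWT : WeightedTalagrand) (hF : FHKLTotalL1) (hG : WTGivesAA) (hT : PromiseTransfer)
    (hX : RandomOracleHeurSeparation) (hPL : PromiseLanguageLift) : _root_.QuantumAdvantage := by
  by_contra hS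
  refine hX (hT (hG hWT hF) (hPL ?_))
  intro L hL
  by_contra hL'
  exact hS ⟨L, hL, hL'⟩

end Summit.QuantumAdvantage.QuantumAdvantage.Theses.SpikesNeedAddresses
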